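import Mathlib

/-!
# A scattered cell: the big-`g` positions carry half of `g` and little of `f`

Crux `Summit.MatrixMultiplication.MatrixMultiplication.Theses.SnSubsetDichotomy.PolynomialSlack`
(item `stmt-MatrixMultiplication-8306`), level-one programme, lead c7 (two dense quotients, matching branch).
-/

namespace Summit.MatrixMultiplication.MatrixMultiplication.Theorems.PolynomialSlack

set_option linter.dupNamespace false

open scoped BigOperators

/-- **Scattered cell.** If `f, g ≥ 0` on `Fin n`, `Σ g = 1` and `Σ f g ≤ ε/n`, then the set
`Q = {j : 1/(2n) ≤ g j}` has `Σ_Q g ≥ 1/2` (the complement carries `< n·1/(2n)`) and `Σ_Q f ≤ 2ε`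
(on `Q`, `f ≤ 2n·f g`). [folklore] -/
theorem scatter_cell {n : ℕ} (f g : Fin n → ℝ) (ε : ℝ) (hf0 : ∀ j, 0 ≤ f j) (hg0 : ∀ j, 0 ≤ g j)
    (hg1 : ∑ j, g j = 1) (hfg : ∑ j, f j * g j ≤ ε / n) :
    1 / 2 ≤ ∑ j ∈ Finset.univ.filter (fun j => 1 / (2 * (n : ℝ)) ≤ g j), g j ∧
      ∑ j ∈ Finset.univ.filter (fun j => 1 / (2 * (n : ℝ)) ≤ g j), f j ≤ 2 * ε := by
  rcases Nat.eq_zero_or_pos n with rfl | hn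
  · simp at hg1
  have hnR : (0 : ℝ) < n := by exact_mod_cast hn
  have h2n : (0 : ℝ) < 2 * (n : ℝ) := by positivity
  constructor
  · -- (a) the complement of `Q` carries at most `n · 1/(2n) = 1/2` of the mass of `g`
    have hsplit := Finset.sum_filter_add_sum_filter_not Finset.univ
      (fun j : Fin n => 1 / (2 * (n : ℝ)) ≤ g j) g
    rw [hg1] at hsplit
    have hcomp : ∑ j ∈ Finset.univ.filter (fun j : Fin n => ¬ (1 / (2 * (n : ℝ)) ≤ g j)), g j
        ≤ 1 / 2 := by
      calc ∑ j ∈ Finset.univ.filter (fun j : Fin n => ¬ (1 / (2 * (n : ℝ)) ≤ g j)), g j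
          ≤ ∑ j ∈ Finset.univ.filter (fun j : Fin n => ¬ (1 / (2 * (n : ℝ)) ≤ g j)),
              1 / (2 * (n : ℝ)) := by
            apply Finset.sum_le_sum
            intro j hj
            simp only [Finset.mem_filter, Finset.mem_univ, true_and, not_le] at hj
            exact hj.le
        _ = ((Finset.univ.filter (fun j : Fin n => ¬ (1 / (2 * (n : ℝ)) ≤ g j))).card : ℝ)
              * (1 / (2 * (n : ℝ))) := by
            rw [Finset.sum_const, nsmul_eq_mul]
        _ ≤ (n : ℝ) * (1 / (2 * (n : ℝ))) := by
            apply mul_le_mul_of_nonneg_right _ (by positivity)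
            have hc := Finset.card_le_univ
              (Finset.univ.filter (fun j : Fin n => ¬ (1 / (2 * (n : ℝ)) ≤ g j)))
            rw [Fintype.card_fin] at hc
            exact_mod_cast hc
        _ = 1 / 2 := by field_simp
    linarith
  · -- (b) on `Q`, `f j ≤ 2n · (f j · g j)`
    have hQsub : ∑ j ∈ Finset.univ.filter (fun j : Fin n => 1 / (2 * (n : ℝ)) ≤ g j), f j * g j
        ≤ ∑ j, f j * g j :=
      Finset.sum_le_sum_of_subset_of_nonneg (Finset.filter_subset _ _)
        (fun j _ _ => mul_nonneg (hf0 j) (hg0 j))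
    have hterm : ∀ j ∈ Finset.univ.filter (fun j : Fin n => 1 / (2 * (n : ℝ)) ≤ g j),
        f j ≤ 2 * (n : ℝ) * (f j * g j) := by
      intro j hj
      simp only [Finset.mem_filter, Finset.mem_univ, true_and] at hj
      have h1 : 1 ≤ 2 * (n : ℝ) * g j := by
        rw [div_le_iff₀ h2n] at hj
        linarith
      calc f j = f j * 1 := (mul_one _).symm
        _ ≤ f j * (2 * (n : ℝ) * g j) := mul_le_mul_of_nonneg_left h1 (hf0 j)
        _ = 2 * (n : ℝ) * (f j * g j) := by ring
    calc ∑ j ∈ Finset.univ.filter (fun j : Fin n => 1 / (2 * (n : ℝ)) ≤ g j), f j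
        ≤ ∑ j ∈ Finset.univ.filter (fun j : Fin n => 1 / (2 * (n : ℝ)) ≤ g j),
            2 * (n : ℝ) * (f j * g j) := Finset.sum_le_sum hterm
      _ = 2 * (n : ℝ) *
            ∑ j ∈ Finset.univ.filter (fun j : Fin n => 1 / (2 * (n : ℝ)) ≤ g j), f j * g j := by
          rw [Finset.mul_sum]
      _ ≤ 2 * (n : ℝ) * ∑ j, f j * g j := mul_le_mul_of_nonneg_left hQsub h2n.le
      _ ≤ 2 * (n : ℝ) * (ε / n) := mul_le_mul_of_nonneg_left hfg h2n.le
      _ = 2 * ε := by field_simp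

end Summit.MatrixMultiplication.MatrixMultiplication.Theorems.PolynomialSlack
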